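import Summits.AtomisticToContinuum.Crystallization.Theorems.ChartedPlanarOrderHeightFloor

/-!
# Continuation (part B) of `ChartedPlanarOrderHeightFloor` — lens-3 g25 (a) HeightFloor 47b92903 (424 l), PRE-SPLIT by hand-2 g12 for the gate's 400-line rule
(bodies byte-identical, same namespace `Summit.AtomisticToContinuum.Crystallization.Theorems.ChartedPlanarOrderHeightFloor`; see the module docstring of part A for the content and tags).
-/

noncomputable section

namespace Summit.AtomisticToContinuum.Crystallization.Theorems.ChartedPlanarOrderHeightFloor

open Set Metric
open scoped RealInnerProductSpace
open Summit.AtomisticToContinuum.Crystallization.Theorems.ChartedPlanarOrderRigidityDoor (E3)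
open Summit.AtomisticToContinuum.Crystallization.Theorems.ChartedPlanarOrderDoorLayered (Layered)
open Summit.AtomisticToContinuum.Crystallization.Theorems.ChartedPlanarOrderLayerFrame (norm_sq_eq_planar_add_height
  norm_sq_add_smul_normal exists_planar_coords)
open Summit.AtomisticToContinuum.Crystallization.Theorems.ChartedPlanarOrderStackedLayerGeometry (sub_period_mem add_period_mem offset_mem
  inner_period_combo)
open Summit.AtomisticToContinuum.Crystallization.Theorems.ChartedPlanarOrderProfileSlavingLJ (IsStacked incr)
open Summit.AtomisticToContinuum.Crystallization.Theorems.OverbindingBudgetPeriodicCleanOrStrained (UniformlyClean)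
open Summit.AtomisticToContinuum.Crystallization.Theorems.OverbindingBudgetViolatorDensityFloor (RT)
open Summit.AtomisticToContinuum.Crystallization.Theorems.ChartedPlanarOrderPairModulus (gram_pos)
open Summit.AtomisticToContinuum.Crystallization.Theorems.ChartedPlanarOrderSepCounting (exists_unit_normal)
open Summit.AtomisticToContinuum.Crystallization.Theorems.ChartedPlanarOrderLatticeSmear (norm_sq_lin)

/-! ## §3 The cell windows and the height floor of a uniformly clean stacked configuration -/

section Config

variable {a b ν : E3} {w : ℤ → E3} {a' : ℝ}

/-- `a + b ≠ 0` and `a − b ≠ 0` for independent `a, b`. [folklore] -/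
theorem add_ne_zero_of_li (hab : LinearIndependent ℝ ![a, b]) : a + b ≠ 0 ∧ a - b ≠ 0 := by
  have h := LinearIndependent.pair_iff.1 hab
  constructor
  · intro e
    have := h 1 1 (by rw [one_smul, one_smul, e])
    norm_num at this
  · intro e
    have := h 1 (-1) (by rw [one_smul, neg_one_smul, ← sub_eq_add_neg, e])
    norm_num at this

/-- ★ CELL WINDOWS of a uniformly clean layered configuration with periods `≤ 17/16`: `‖a‖, ‖b‖ ∈ [49a'/50, 51a'/50]`,
`‖a ± b‖ ≥ 49a'/50`, and the T/S dichotomy of the shorter diagonal. -/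
theorem cellWindows (h : ∀ y ∈ Layered a b w, ∀ s : ℝ, 0 < s → RT a' s (Layered a b w) y) (ha' : 47 / 50 ≤ a')
    (hab : LinearIndependent ℝ ![a, b]) (ha : ‖a‖ ≤ 17 / 16) (hb : ‖b‖ ≤ 17 / 16) :
    (a' * (49 / 50) ≤ ‖a‖ ∧ ‖a‖ ≤ a' * (51 / 50)) ∧ (a' * (49 / 50) ≤ ‖b‖ ∧ ‖b‖ ≤ a' * (51 / 50)) ∧
      a' * (49 / 50) ≤ ‖a - b‖ ∧ a' * (49 / 50) ≤ ‖a + b‖ ∧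
      (min ‖a - b‖ ‖a + b‖ ≤ a' * (51 / 50) ∨ a' * (63 / 50) ≤ min ‖a - b‖ ‖a + b‖) := by
  have hq : w 0 ∈ Layered a b w := offset_mem 0
  have ha0 : a ≠ 0 := by simpa using hab.ne_zero 0
  have hb0 : b ≠ 0 := by simpa using hab.ne_zero 1
  obtain ⟨hp0, hm0⟩ := add_ne_zero_of_li hab
  have hqa : w 0 + a ∈ Layered a b w := by simpa using add_period_mem hq 1 0
  have hqb : w 0 + b ∈ Layered a b w := by simpa using add_period_mem hq 0 1
  have hqp : w 0 + (a + b) ∈ Layered a b w := by simpa using add_period_mem hq 1 1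
  have hqm : w 0 + (a - b) ∈ Layered a b w := by simpa [sub_eq_add_neg] using add_period_mem hq 1 (-1)
  refine ⟨norm_le_of_RT h ha' hq hqa ha0 ha, norm_le_of_RT h ha' hq hqb hb0 hb, (norm_window_of_RT h hq hqm hm0).1,
    (norm_window_of_RT h hq hqp hp0).1, ?_⟩
  rcases le_total ‖a - b‖ ‖a + b‖ with hle | hle
  · rw [min_eq_left hle]; exact (norm_window_of_RT h hq hqm hm0).2
  · rw [min_eq_right hle]; exact (norm_window_of_RT h hq hqp hp0).2

/-- `min(‖a−b‖,‖a+b‖)² = ‖a‖² + ‖b‖² − 2|⟪a,b⟫|`. [folklore] -/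
theorem min_diag_sq (a b : E3) : (min ‖a - b‖ ‖a + b‖) ^ 2 = ‖a‖ ^ 2 + ‖b‖ ^ 2 - 2 * |⟪a, b⟫| := by
  have hm : ‖a - b‖ ^ 2 = ‖a‖ ^ 2 + ‖b‖ ^ 2 - 2 * ⟪a, b⟫ := by rw [norm_sub_sq_real]; ring
  have hp : ‖a + b‖ ^ 2 = ‖a‖ ^ 2 + ‖b‖ ^ 2 + 2 * ⟪a, b⟫ := by rw [norm_add_sq_real]; ring
  rcases le_or_gt 0 ⟪a, b⟫ with h0 | h0
  · rw [abs_of_nonneg h0]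
    have hle : ‖a - b‖ ≤ ‖a + b‖ := by nlinarith [norm_nonneg (a - b), norm_nonneg (a + b)]
    rw [min_eq_left hle, hm]
  · rw [abs_of_neg h0]
    have hle : ‖a + b‖ ≤ ‖a - b‖ := by nlinarith [norm_nonneg (a - b), norm_nonneg (a + b)]
    rw [min_eq_right hle, hp]; ring

/-- `min(‖a−b‖²,‖a+b‖²) = min(‖a−b‖,‖a+b‖)²`. [folklore] -/
theorem min_sq_eq (a b : E3) : min (‖a - b‖ ^ 2) (‖a + b‖ ^ 2) = (min ‖a - b‖ ‖a + b‖) ^ 2 := by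
  rcases le_total ‖a - b‖ ‖a + b‖ with h | h
  · rw [min_eq_left h, min_eq_left (pow_le_pow_left₀ (norm_nonneg _) h 2)]
  · rw [min_eq_right h, min_eq_right (pow_le_pow_left₀ (norm_nonneg _) h 2)]

/-- the Gram determinant through the shorter diagonal: `4G = 2xy + 2xz + 2yz − x² − y² − z²`, `z = min(‖a−b‖,‖a+b‖)²`. [folklore] -/
theorem four_gram_eq (a b : E3) :
    4 * (‖a‖ ^ 2 * ‖b‖ ^ 2 - ⟪a, b⟫ ^ 2) =
      2 * ‖a‖ ^ 2 * ‖b‖ ^ 2 + 2 * ‖a‖ ^ 2 * (min ‖a - b‖ ‖a + b‖) ^ 2 + 2 * ‖b‖ ^ 2 * (min ‖a - b‖ ‖a + b‖) ^ 2 -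
        (‖a‖ ^ 2) ^ 2 - (‖b‖ ^ 2) ^ 2 - ((min ‖a - b‖ ‖a + b‖) ^ 2) ^ 2 := by
  rw [min_diag_sq, show ⟪a, b⟫ ^ 2 = |⟪a, b⟫| ^ 2 by rw [sq_abs]]
  ring

/-- the universal circumradius bound `R² ≤ (x+y)/4` in window form: `x y (x + y − 2q) ≤ (x + y)(x y − q²)` for `x, y ∈ [c, C]`,
`0 ≤ q`, `2q ≤ x + y − c`, `(C − c)² ≤ 2c²`. [folklore] -/
theorem circ_univ {x y q c C : ℝ} (hc : 0 < c) (hx : c ≤ x) (hxC : x ≤ C) (hy : c ≤ y) (hyC : y ≤ C) (hq0 : 0 ≤ q)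
    (hq : 2 * q ≤ x + y - c) (hCc : (C - c) ^ 2 ≤ 2 * c ^ 2) : x * y * (x + y - 2 * q) ≤ (x + y) * (x * y - q ^ 2) := by
  have h1 : (x - y) ^ 2 ≤ (C - c) ^ 2 := sq_le_sq' (by linarith) (by linarith)
  have hcx : c * c ≤ c * x := mul_le_mul_of_nonneg_left hx hc.le
  have hcy : c * c ≤ c * y := mul_le_mul_of_nonneg_left hy hc.le
  have h2 : (x + y) * (x + y - c) ≤ 4 * (x * y) := by nlinarith [h1, hCc, hcx, hcy]
  have h3 : (x + y) * (2 * q) ≤ (x + y) * (x + y - c) := mul_le_mul_of_nonneg_left hq (by linarith)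
  have h4 : (x + y) * q ≤ 2 * (x * y) := by linarith
  nlinarith [mul_nonneg hq0 (sub_nonneg.2 h4)]

/-- the near-equilateral circumradius bound: `3xyz ≤ M·(2xy+2xz+2yz−x²−y²−z²)` for `x, y, z ∈ [3M/4, M]`. [folklore] -/
theorem three_xyz_le {x y z M : ℝ} (hxM : x ≤ M) (hyM : y ≤ M) (hzM : z ≤ M) (hx : 3 / 4 * M ≤ x) (hy : 3 / 4 * M ≤ y)
    (hz : 3 / 4 * M ≤ z) : 3 * (x * y * z) ≤ M * (2 * x * y + 2 * x * z + 2 * y * z - x ^ 2 - y ^ 2 - z ^ 2) := by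
  have hα : 0 ≤ M - x := by linarith
  have hβ : 0 ≤ M - y := by linarith
  have hγ : 0 ≤ M - z := by linarith
  have hS : (M - x) + (M - y) + (M - z) ≤ M := by linarith
  have hM : 0 ≤ M := by linarith
  -- `M·D − 3xyz = M·[M Σα − Σαβ − Σα²] + 3αβγ ≥ M·Σα·(M − Σα) + 3αβγ ≥ 0`
  nlinarith [mul_nonneg (mul_nonneg hα hβ) hγ, mul_nonneg hM (mul_nonneg (add_nonneg (add_nonneg hα hβ) hγ) (sub_nonneg.2 hS)),
    mul_nonneg hM (mul_nonneg hα hβ), mul_nonneg hM (mul_nonneg hα hγ), mul_nonneg hM (mul_nonneg hβ hγ)]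

/-- ★ SHARP NEXT-LAYER ATOM: a layer-`(m+1)` atom at height `H_{m+1}` above `w m` with planar offset at most the circumradius:
`‖y − w m‖² ≤ ‖a‖²‖b‖²·min(‖a−b‖²,‖a+b‖²)/(4G) + H²`. -/
theorem exists_next_layer_atom_sharp (hν1 : ‖ν‖ = 1) (hνa : ⟪ν, a⟫ = 0) (hνb : ⟪ν, b⟫ = 0) (ha0 : a ≠ 0)
    (hG : 0 < ‖a‖ ^ 2 * ‖b‖ ^ 2 - ⟪a, b⟫ ^ 2) (m : ℤ) :
    ∃ y ∈ Layered a b w, ⟪ν, y - w m⟫ = ⟪ν, w (m + 1) - w m⟫ ∧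
      ‖y - w m‖ ^ 2 ≤ ‖a‖ ^ 2 * ‖b‖ ^ 2 * min (‖a - b‖ ^ 2) (‖a + b‖ ^ 2) / (4 * (‖a‖ ^ 2 * ‖b‖ ^ 2 - ⟪a, b⟫ ^ 2)) +
        ⟪ν, w (m + 1) - w m⟫ ^ 2 := by
  set H := ⟪ν, w (m + 1) - w m⟫ with hH
  set t := (w (m + 1) - w m) - H • ν with ht
  have hνt : ⟪ν, t⟫ = 0 := (norm_sq_eq_planar_add_height hν1 (w (m + 1) - w m)).1
  obtain ⟨α, β, hαβ⟩ := exists_planar_coords hν1 hνa hνb hνt hG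
  obtain ⟨i, j, hij⟩ := exists_lattice_near_min a b ha0 hG α β
  rw [← hαβ] at hij
  refine ⟨w (m + 1) - ((i : ℝ) • a + (j : ℝ) • b), sub_period_mem (offset_mem (m + 1)) i j, ?_, ?_⟩
  · have h0 := inner_period_combo (ν := ν) hνa hνb (i : ℝ) (j : ℝ)
    rw [show w (m + 1) - ((i : ℝ) • a + (j : ℝ) • b) - w m = (w (m + 1) - w m) - ((i : ℝ) • a + (j : ℝ) • b) by abel,
      inner_sub_right, h0, sub_zero]
  · have hdec : w (m + 1) - ((i : ℝ) • a + (j : ℝ) • b) - w m = (t - ((i : ℝ) • a + (j : ℝ) • b)) + H • ν := by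
      rw [ht]; abel
    have hνt' : ⟪ν, t - ((i : ℝ) • a + (j : ℝ) • b)⟫ = 0 := by
      rw [inner_sub_right, hνt, inner_period_combo hνa hνb, sub_zero]
    rw [hdec, norm_sq_add_smul_normal hν1 hνt' H]
    linarith

/-- ★★ THE HEIGHT FLOOR.  For a uniformly clean (`RT a'` at every margin, `a' ≥ 47/50`) layered configuration with independent periods
`‖a‖, ‖b‖ ≤ 17/16` and a unit normal `ν` along which the layer heights increase: every increment has height `≥ 33a'/50`, and `≥ 39a'/50`
when the cell is near-triangular (`min(‖a−b‖,‖a+b‖) ≤ 51a'/50`). -/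
theorem heightFloor (h : ∀ y ∈ Layered a b w, ∀ s : ℝ, 0 < s → RT a' s (Layered a b w) y) (ha' : 47 / 50 ≤ a')
    (hab : LinearIndependent ℝ ![a, b]) (ha : ‖a‖ ≤ 17 / 16) (hb : ‖b‖ ≤ 17 / 16) (hν1 : ‖ν‖ = 1) (hνa : ⟪ν, a⟫ = 0) (hνb : ⟪ν, b⟫ = 0)
    (hpos : ∀ m : ℤ, 0 < ⟪ν, w (m + 1) - w m⟫) (m : ℤ) :
    a' * (33 / 50) ≤ ⟪ν, w (m + 1) - w m⟫ ∧ (min ‖a - b‖ ‖a + b‖ ≤ a' * (51 / 50) → a' * (39 / 50) ≤ ⟪ν, w (m + 1) - w m⟫) := by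
  obtain ⟨⟨halo, hahi⟩, ⟨hblo, hbhi⟩, hmlo, hplo, _⟩ := cellWindows h ha' hab ha hb
  have ha0 : a ≠ 0 := by simpa using hab.ne_zero 0
  have hG := gram_pos hab
  have hH0 : 0 < ⟪ν, w (m + 1) - w m⟫ := hpos m
  have ha'0 : 0 < a' := by linarith
  obtain ⟨y, hy, hyH, hyd⟩ := exists_next_layer_atom_sharp (w := w) hν1 hνa hνb ha0 hG m
  rw [min_sq_eq] at hyd
  have hyq : y ≠ w m := by
    intro e
    rw [e, sub_self, inner_zero_right] at hyH
    exact hH0.ne hyH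
  have hdist := dist_ge_of_RT h hy (offset_mem m) hyq
  rw [dist_eq_norm] at hdist
  have hd2 : (a' * (49 / 50)) ^ 2 ≤ ‖y - w m‖ ^ 2 := pow_le_pow_left₀ (by positivity) hdist 2
  have hzlo : a' * (49 / 50) ≤ min ‖a - b‖ ‖a + b‖ := le_min hmlo hplo
  have hxlo : (a' * (49 / 50)) ^ 2 ≤ ‖a‖ ^ 2 := pow_le_pow_left₀ (by positivity) halo 2
  have hxhi : ‖a‖ ^ 2 ≤ (a' * (51 / 50)) ^ 2 := pow_le_pow_left₀ (norm_nonneg _) hahi 2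
  have hylo : (a' * (49 / 50)) ^ 2 ≤ ‖b‖ ^ 2 := pow_le_pow_left₀ (by positivity) hblo 2
  have hyhi : ‖b‖ ^ 2 ≤ (a' * (51 / 50)) ^ 2 := pow_le_pow_left₀ (norm_nonneg _) hbhi 2
  have hz2lo : (a' * (49 / 50)) ^ 2 ≤ (min ‖a - b‖ ‖a + b‖) ^ 2 := pow_le_pow_left₀ (by positivity) hzlo 2
  have hzsq := min_diag_sq a b
  have h4Gpos : 0 < 4 * (‖a‖ ^ 2 * ‖b‖ ^ 2 - ⟪a, b⟫ ^ 2) := by linarith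
  constructor
  · -- universal: `R² ≤ (‖a‖² + ‖b‖²)/4`
    have hq : 2 * |⟪a, b⟫| ≤ ‖a‖ ^ 2 + ‖b‖ ^ 2 - (a' * (49 / 50)) ^ 2 := by linarith
    have hCc : ((a' * (51 / 50)) ^ 2 - (a' * (49 / 50)) ^ 2) ^ 2 ≤ 2 * ((a' * (49 / 50)) ^ 2) ^ 2 := by
      nlinarith [pow_nonneg ha'0.le 4]
    have hL1 := circ_univ (by positivity) hxlo hxhi hylo hyhi (abs_nonneg ⟪a, b⟫) hq hCc
    have hR2 : ‖a‖ ^ 2 * ‖b‖ ^ 2 * (min ‖a - b‖ ‖a + b‖) ^ 2 / (4 * (‖a‖ ^ 2 * ‖b‖ ^ 2 - ⟪a, b⟫ ^ 2)) ≤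
        (‖a‖ ^ 2 + ‖b‖ ^ 2) / 4 := by
      rw [div_le_iff₀ h4Gpos, hzsq, ← sq_abs ⟪a, b⟫]
      linarith
    have hH2 : (a' * (33 / 50)) ^ 2 ≤ ⟪ν, w (m + 1) - w m⟫ ^ 2 := by linarith
    exact (pow_le_pow_iff_left₀ (by positivity) hH0.le two_ne_zero).1 hH2
  · intro hT
    have hz0 : 0 ≤ min ‖a - b‖ ‖a + b‖ := le_min (norm_nonneg _) (norm_nonneg _)
    have hz2hi : (min ‖a - b‖ ‖a + b‖) ^ 2 ≤ (a' * (51 / 50)) ^ 2 := pow_le_pow_left₀ hz0 hT 2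
    have hM34 : 3 / 4 * (a' * (51 / 50)) ^ 2 ≤ (a' * (49 / 50)) ^ 2 := by nlinarith [pow_nonneg ha'0.le 2]
    have h3 := three_xyz_le hxhi hyhi hz2hi (hM34.trans hxlo) (hM34.trans hylo) (hM34.trans hz2lo)
    have h4G := four_gram_eq a b
    have hR2 : ‖a‖ ^ 2 * ‖b‖ ^ 2 * (min ‖a - b‖ ‖a + b‖) ^ 2 / (4 * (‖a‖ ^ 2 * ‖b‖ ^ 2 - ⟪a, b⟫ ^ 2)) ≤
        (a' * (51 / 50)) ^ 2 / 3 := by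
      rw [div_le_div_iff₀ h4Gpos (by norm_num : (0:ℝ) < 3), h4G]
      linarith
    have hH2 : (a' * (39 / 50)) ^ 2 ≤ ⟪ν, w (m + 1) - w m⟫ ^ 2 := by linarith
    exact (pow_le_pow_iff_left₀ (by positivity) hH0.le two_ne_zero).1 hH2

/-- ★ INNER-PRODUCT and GRAM windows: `|⟪a,b⟫| ≤ (‖a‖² + ‖b‖² − (49a'/50)²)/2` always, `|⟪a,b⟫| ≤ (‖a‖² + ‖b‖² − (63a'/50)²)/2` over
a near-square cell, and the UNIVERSAL Gram floor `G ≥ 3(49a'/50)⁴/4` (`xy − ((x+y−c)/2)² ≥ 3c²/4` on the window box). -/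
theorem innerWindows (h : ∀ y ∈ Layered a b w, ∀ s : ℝ, 0 < s → RT a' s (Layered a b w) y) (ha' : 47 / 50 ≤ a')
    (hab : LinearIndependent ℝ ![a, b]) (ha : ‖a‖ ≤ 17 / 16) (hb : ‖b‖ ≤ 17 / 16) :
    |⟪a, b⟫| ≤ (‖a‖ ^ 2 + ‖b‖ ^ 2 - (a' * (49 / 50)) ^ 2) / 2 ∧
      (a' * (63 / 50) ≤ min ‖a - b‖ ‖a + b‖ → |⟪a, b⟫| ≤ (‖a‖ ^ 2 + ‖b‖ ^ 2 - (a' * (63 / 50)) ^ 2) / 2) ∧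
      3 / 4 * (a' * (49 / 50)) ^ 4 ≤ ‖a‖ ^ 2 * ‖b‖ ^ 2 - ⟪a, b⟫ ^ 2 := by
  obtain ⟨⟨halo, hahi⟩, ⟨hblo, hbhi⟩, hmlo, hplo, _⟩ := cellWindows h ha' hab ha hb
  have hz := min_diag_sq a b
  set z := min ‖a - b‖ ‖a + b‖
  have hzlo : a' * (49 / 50) ≤ z := le_min hmlo hplo
  have hz2lo : (a' * (49 / 50)) ^ 2 ≤ z ^ 2 := pow_le_pow_left₀ (by linarith) hzlo 2
  have hp : |⟪a, b⟫| ≤ (‖a‖ ^ 2 + ‖b‖ ^ 2 - (a' * (49 / 50)) ^ 2) / 2 := by linarith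
  refine ⟨hp, fun hS => ?_, ?_⟩
  · have : (a' * (63 / 50)) ^ 2 ≤ z ^ 2 := pow_le_pow_left₀ (by linarith) hS 2
    linarith
  · have hxlo : (a' * (49 / 50)) ^ 2 ≤ ‖a‖ ^ 2 := pow_le_pow_left₀ (by linarith) halo 2
    have hxhi : ‖a‖ ^ 2 ≤ (a' * (51 / 50)) ^ 2 := pow_le_pow_left₀ (norm_nonneg _) hahi 2
    have hylo : (a' * (49 / 50)) ^ 2 ≤ ‖b‖ ^ 2 := pow_le_pow_left₀ (by linarith) hblo 2
    have hyhi : ‖b‖ ^ 2 ≤ (a' * (51 / 50)) ^ 2 := pow_le_pow_left₀ (norm_nonneg _) hbhi 2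
    have hp2 : ⟪a, b⟫ ^ 2 ≤ ((‖a‖ ^ 2 + ‖b‖ ^ 2 - (a' * (49 / 50)) ^ 2) / 2) ^ 2 := by
      rw [← sq_abs]; exact pow_le_pow_left₀ (abs_nonneg _) hp 2
    -- `xy − ((x+y−c)/2)² ≥ 3c²/4` on the box `[c, C]²`, `c = (49a'/50)²`, `C = (51a'/50)² ≤ 3c`
    nlinarith [mul_nonneg (sub_nonneg.2 hxlo) (sub_nonneg.2 hxhi), mul_nonneg (sub_nonneg.2 hylo) (sub_nonneg.2 hyhi),
      mul_nonneg (sub_nonneg.2 hxlo) (sub_nonneg.2 hylo), mul_nonneg (sub_nonneg.2 hxlo) (sub_nonneg.2 hyhi),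
      mul_nonneg (sub_nonneg.2 hylo) (sub_nonneg.2 hxhi), mul_pos (by linarith : (0:ℝ) < a') (by linarith : (0:ℝ) < a')]

end Config

/-! ## §4 Packaged: the clean stacked windows under the binder list of `TubeConvexRef` -/

/-- ★★ PACKAGED (binder list of `TubeConvexRef` / `PairModulusTailRef`): a uniformly clean stacked configuration with independent periods
`‖a‖, ‖b‖ ≤ 17/16` has a unit normal `ν ⊥ a, b` and a clean spacing `a' ∈ [47/50, 1]` with the cell windows, the T/S dichotomy and the
height floors `⟪ν, incr w i⟫ ≥ 33a'/50` (all cells) / `≥ 39a'/50` (near-triangular cell). -/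
theorem cleanStackedWindows {a b : E3} {w : ℤ → E3} (hst : IsStacked a b w) (hab : LinearIndependent ℝ ![a, b]) (ha : ‖a‖ ≤ 17 / 16)
    (hb : ‖b‖ ≤ 17 / 16) (hUC : UniformlyClean (Layered a b w)) :
    ∃ (ν : E3) (a' : ℝ), ‖ν‖ = 1 ∧ ⟪ν, a⟫ = 0 ∧ ⟪ν, b⟫ = 0 ∧ 47 / 50 ≤ a' ∧ a' ≤ 1 ∧
      (a' * (49 / 50) ≤ ‖a‖ ∧ ‖a‖ ≤ a' * (51 / 50)) ∧ (a' * (49 / 50) ≤ ‖b‖ ∧ ‖b‖ ≤ a' * (51 / 50)) ∧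
      |⟪a, b⟫| ≤ (‖a‖ ^ 2 + ‖b‖ ^ 2 - (a' * (49 / 50)) ^ 2) / 2 ∧
      (min ‖a - b‖ ‖a + b‖ ≤ a' * (51 / 50) ∨ a' * (63 / 50) ≤ min ‖a - b‖ ‖a + b‖) ∧
      (a' * (63 / 50) ≤ min ‖a - b‖ ‖a + b‖ → |⟪a, b⟫| ≤ (‖a‖ ^ 2 + ‖b‖ ^ 2 - (a' * (63 / 50)) ^ 2) / 2) ∧
      3 / 4 * (a' * (49 / 50)) ^ 4 ≤ ‖a‖ ^ 2 * ‖b‖ ^ 2 - ⟪a, b⟫ ^ 2 ∧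
      (∀ i : ℤ, a' * (33 / 50) ≤ ⟪ν, incr w i⟫) ∧
      (min ‖a - b‖ ‖a + b‖ ≤ a' * (51 / 50) → ∀ i : ℤ, a' * (39 / 50) ≤ ⟪ν, incr w i⟫) := by
  obtain ⟨ν, hν1, hνa, hνb, hpos⟩ := exists_unit_normal hst
  obtain ⟨a', ha'lo, ha'hi, hRT⟩ := hUC
  obtain ⟨hwa, hwb, -, -, hTS⟩ := cellWindows hRT ha'lo hab ha hb
  obtain ⟨hp, hpS, hGT⟩ := innerWindows hRT ha'lo hab ha hb
  have hincr : ∀ i : ℤ, incr w i = w (i - 1 + 1) - w (i - 1) := fun i => by rw [sub_add_cancel]; rfl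
  refine ⟨ν, a', hν1, hνa, hνb, ha'lo, ha'hi, hwa, hwb, hp, hTS, hpS, hGT, fun i => ?_, fun hT i => ?_⟩
  · rw [hincr]; exact (heightFloor hRT ha'lo hab ha hb hν1 hνa hνb hpos (i - 1)).1
  · rw [hincr]; exact (heightFloor hRT ha'lo hab ha hb hν1 hνa hνb hpos (i - 1)).2 hT

end Summit.AtomisticToContinuum.Crystallization.Theorems.ChartedPlanarOrderHeightFloor
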